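/-
Free seat `ym-line-cbag-p1` LEAD (prover-ym-line-cbag-p1-g5-0; own items 22254 `BoxFloorAllGroups` / 22893 `ExpChartPackage2` closed), route
`ColdBoxAllGroups`, helping crux `BulkAllGroups` (stmt-QuantumFields-22255), line `dlr-chessboard-G` (lead `ym-line-cbag-p2`): preliminaries of
the two expansion stubs about the BACKGROUND of a scaled exterior datum — vocabulary-free G-port of `…BulkDominatesColdBoxWKernelMeanPrelims`
§OffTouching and `…BulkDominatesColdBoxWKernelCovDatumCore` §§1–2, plus the `sdatE`-wrappers in the lead's `D`-colour vocabulary.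
-/
import Summits.QuantumFields.YangMills.Theorems.ColdBoxAllGroupsBulkAllGroupsGlueShiftBoundsG
import Summits.QuantumFields.YangMills.Theorems.ColdBoxAllGroupsOneScaleDatumDefsG
import Summits.QuantumFields.YangMills.Theorems.WeakCouplingRatesBulkDominatesColdBoxWKernelMeanPrelims
import Summits.QuantumFields.YangMills.Theorems.WeakCouplingRatesBulkDominatesColdBoxWShiftSmall

/-!
# Crux `BulkAllGroups` (stmt-QuantumFields-22255), stubs N2-mean-G / N2-cov-G: the background circulation of a scaled exterior datum —
# per colour and for an arbitrary scaling, then in the `D`-colour `√β`-vocabulary (`sdatE`)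

In the one-scale expansion with an exterior datum the Gaussian reference of colour `c` is the translate of D1' by the harmonic extension of the
SCALED datum `s•θ` (`θ = ϑ_c : edges → ℝ`, `s = √(2β)` in the gnomonic `SU(2)` line, `s = √β` in the exponential chart of a general compact group —
`sdatE β ϑ c`, `Theorems/ColdBoxAllGroupsOneScaleDatumDefsG.lean`).  Its background circulation `F̄[s•θ](p) = sCirc (glue (s•θ) (mean (s•θ))) p`
enters the mean / covariance cores through a uniform bound `|F̄| ≤ R'` on ALL plaquettes and through the observation that AWAY from the plaquettes
touching the cold box it is a pure datum circulation.  Everything here is linear bookkeeping on top of G-free tree lemmas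
(`abs_glue_zero_le`, `abs_sCirc_glue_zero_le`, `sCirc_glue_dir_congr_of_not_touching`, `dirBackground_touching_sq_le_formM`):

* per colour, arbitrary scaling `s` (hypotheses: `|θ e| ≤ r` off the cold box `Λ = boxEdges 4 (2H+1)`, `θ = 0` on the temporal forest):
  `abs_smul_apply_le_of_pinned` (`|(s•θ) e| ≤ |s|r` on the pinned edges of the enlarged box), `abs_glue_smul_le_of_not_mem`
  (`|glue (s•θ) m e| ≤ |s|r` off `Λ`, any free data `m`), `abs_dirBackground_smul_le_of_not_touching` (`|F̄[s•θ](p)| ≤ 4|s|r` off the touching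
  plaquettes), `abs_dirBackground_smul_le` (`|F̄[s•θ](p)| ≤ |s|√B + 4|s|r` on ALL plaquettes when the one-colour pinned Maxwell energy of some
  competitor is `≤ B`);
* `D` colours, `sdatE β ϑ c = √β•ϑ c`, `Σ_c ϑ_c(e)² ≤ r²` off `Λ`, energy clause `Σ_c M_{ϑ_c}(s_c) ≤ B` (the datum package
  `exists_datum_packageG`): `abs_sdatE_le_of_pinned`, `abs_glue_sdatE_le_of_not_mem`, `abs_dirBackground_sdatE_le_of_not_touching`
  (`≤ 4(√β·r)`), `abs_dirBackground_sdatE_le` (`≤ √(βB) + 4(√β·r)`) — the `SU(2)` statements with `2β ↦ β`, `Fin 3 ↦ Fin D`;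
* the Gaussian moment constants of the `D`-colour cores under `|F_c|, |G_c| ≤ R'`, `0 ≤ a, b ≤ 1`:
  `sqrt_momentD_two_le` (`√(2DΣ_c(F_c⁴+3a²) + 2DΣ_c(G_c⁴+3b²)) ≤ 2D(R'²+2)`) and `sqrt_momentD_four_le`
  (`√((8D³Σ_c(F_c⁸+105a⁴) + 8D³Σ_c(G_c⁸+105b⁴))/2) ≤ 3D²(R'⁴+11)`), the shapes of `abs_kernelCovG_sub_gaussian_le_moments`.
No new definition; no sorry; standard axioms.  NOT a claim about the mass gap: rung-level support (R2xi-G `XiPow`, RECORD label); the Yang–Mills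
mass gap is NOT proved by any of this.
-/

set_option autoImplicit false

noncomputable section

open Finset
open Literature.Probability.LatticeModels Literature.MathematicalPhysics.QuantumLattice
open Literature.MathematicalPhysics.QuantumFieldTheory Literature.MathematicalPhysics.QuantumFieldTheory.AxialGauge
open Literature.MathematicalPhysics.QuantumFieldTheory.LatticeMaxwell
open Summit.QuantumFields.YangMills.Theorems.WeakCouplingRates

namespace Summit.QuantumFields.YangMills.Theorems.ColdBoxAllGroups

variable {H : ℕ}

/-! ## One colour, arbitrary scaling -/

section OneColour

variable {s r : ℝ} {θ : Literature.MathematicalPhysics.QuantumLattice.ZdEdge 4 → ℝ}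

/-- **The scaled datum on the pinned edges of the enlarged box**: `|(s•θ) e| ≤ |s|·r` (off the cold box from `|θ e| ≤ r`; `0` on the forest,
which carries the only pinned edges INSIDE the cold box). [folklore] -/
theorem abs_smul_apply_le_of_pinned (hr : 0 ≤ r) (hθ : ∀ e, e ∉ boxEdges 4 (2 * H + 1) → |θ e| ≤ r)
    (hforest : ∀ x : Site 4, (∀ k : Fin 4, 1 ≤ x k ∧ x k + 1 ≤ 2 * (H : ℤ)) → θ (x, 0) = 0)
    (e : Literature.MathematicalPhysics.QuantumLattice.ZdEdge 4) (_he : e ∈ boxEdgesAt dirCorner (2 * H + 3)) (hpin : e ∉ dirFreeEdges H) :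
    |(s • θ) e| ≤ |s| * r := by
  rw [Pi.smul_apply, smul_eq_mul, abs_mul]
  refine mul_le_mul_of_nonneg_left ?_ (abs_nonneg _)
  by_cases hΛ : e ∈ boxEdges 4 (2 * H + 1)
  · have hf : e.2 = 0 ∧ ∀ k : Fin 4, 1 ≤ e.1 k ∧ e.1 k + 1 ≤ 2 * (H : ℤ) := by
      by_contra hnot
      exact hpin (mem_dirFreeEdges.2 ⟨hΛ, by simpa using hnot⟩)
    obtain ⟨x, j⟩ := e
    obtain ⟨hj, hx⟩ := hf
    simp only at hj hx
    subst hj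
    rw [hforest x hx, abs_zero]; exact hr
  · exact hθ e hΛ

/-- Off the cold box the glued scaled datum is `≤ |s|·r` in absolute value, whatever the free data (pinned collar value, or `0` off the enlarged
box). [folklore] -/
theorem abs_glue_smul_le_of_not_mem (hr : 0 ≤ r) (hθ : ∀ e, e ∉ boxEdges 4 (2 * H + 1) → |θ e| ≤ r) (m : DirFree H → ℝ)
    {e : Literature.MathematicalPhysics.QuantumLattice.ZdEdge 4} (he : e ∉ boxEdges 4 (2 * H + 1)) :
    |glue (pin := fun e => e ∉ dirFreeEdges H) dirCorner (2 * H + 3) (s • θ) m e| ≤ |s| * r := by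
  by_cases hE : e ∈ boxEdgesAt dirCorner (2 * H + 3)
  · have hpin : e ∉ dirFreeEdges H := fun h => he (mem_dirFreeEdges.1 h).1
    rw [glue_apply_pin _ _ hE hpin, Pi.smul_apply, smul_eq_mul, abs_mul]
    exact mul_le_mul_of_nonneg_left (hθ e he) (abs_nonneg _)
  · rw [glue_apply_of_not_mem _ _ hE, abs_zero]; exact mul_nonneg (abs_nonneg _) hr

/-- **Off the touching plaquettes the background circulation of the scaled datum is a pure datum circulation**, hence `≤ 4·(|s|·r)`. [folklore] -/
theorem abs_dirBackground_smul_le_of_not_touching (hr : 0 ≤ r) (hθ : ∀ e, e ∉ boxEdges 4 (2 * H + 1) → |θ e| ≤ r)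
    (hforest : ∀ x : Site 4, (∀ k : Fin 4, 1 ≤ x k ∧ x k + 1 ≤ 2 * (H : ℤ)) → θ (x, 0) = 0)
    {p : ZdPlaquette 4} (hp : p ∉ plaquettesTouching (boxEdges 4 (2 * H + 1))) :
    |sCirc (glue (pin := fun e => e ∉ dirFreeEdges H) dirCorner (2 * H + 3) (s • θ)
        (mean (fun e => e ∉ dirFreeEdges H) dirCorner (2 * H + 3) (s • θ))) (p.1, p.2.1.1, p.2.1.2)| ≤ 4 * (|s| * r) := by
  rw [sCirc_glue_dir_congr_of_not_touching (s • θ) _ 0 hp]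
  exact abs_sCirc_glue_zero_le (H := H) (s • θ) (by positivity)
    (fun e he hpe => abs_smul_apply_le_of_pinned hr hθ hforest e he hpe) _

/-- **The background circulation of the scaled datum is uniformly bounded on ALL plaquettes of `ℤ⁴`**: `|F̄[s•θ](p)| ≤ |s|·√B + 4·(|s|·r)` when
the one-colour pinned Maxwell energy of some competitor `m` with datum `θ` is `≤ B`.  On a plaquette touching the box this is the energy bound
(`dirBackground_touching_sq_le_formM`, scaled by linearity `sCirc_glue_smul_mean`); a plaquette NOT touching the box is handled by
`abs_dirBackground_smul_le_of_not_touching`. [folklore] -/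
theorem abs_dirBackground_smul_le {B : ℝ} (hr : 0 ≤ r) (hθ : ∀ e, e ∉ boxEdges 4 (2 * H + 1) → |θ e| ≤ r)
    (hforest : ∀ x : Site 4, (∀ k : Fin 4, 1 ≤ x k ∧ x k + 1 ≤ 2 * (H : ℤ)) → θ (x, 0) = 0)
    (m : DirFree H → ℝ) (hE : formM (fun e => e ∉ dirFreeEdges H) dirCorner (2 * H + 3) θ m ≤ B) (p : ZdPlaquette 4) :
    |sCirc (glue (pin := fun e => e ∉ dirFreeEdges H) dirCorner (2 * H + 3) (s • θ)
        (mean (fun e => e ∉ dirFreeEdges H) dirCorner (2 * H + 3) (s • θ))) (p.1, p.2.1.1, p.2.1.2)| ≤ |s| * Real.sqrt B + 4 * (|s| * r) := by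
  have h4 : 0 ≤ 4 * (|s| * r) := by positivity
  have hsB : 0 ≤ |s| * Real.sqrt B := by positivity
  by_cases hp : p ∈ plaquettesTouching (boxEdges 4 (2 * H + 1))
  · rw [sCirc_glue_smul_mean, abs_mul]
    have h1 := dirBackground_touching_sq_le_formM H θ m hp
    have hF : |sCirc (glue (pin := fun e => e ∉ dirFreeEdges H) dirCorner (2 * H + 3) θ
        (mean (fun e => e ∉ dirFreeEdges H) dirCorner (2 * H + 3) θ)) (p.1, p.2.1.1, p.2.1.2)| ≤ Real.sqrt B := by
      rw [← Real.sqrt_sq_eq_abs]; exact Real.sqrt_le_sqrt (h1.trans hE)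
    exact (mul_le_mul_of_nonneg_left hF (abs_nonneg _)).trans (le_add_of_nonneg_right h4)
  · exact (abs_dirBackground_smul_le_of_not_touching hr hθ hforest hp).trans (le_add_of_nonneg_left hsB)

end OneColour

/-! ## `D` colours in the `√β`-vocabulary of the exponential chart (`sdatE`) -/

section Colours

variable {D : ℕ} {β r : ℝ} {ϑ : Fin D → (Literature.MathematicalPhysics.QuantumLattice.ZdEdge 4 → ℝ)}

/-- From `Σ_c ϑ_c(e)² ≤ r²` off the cold box: `|ϑ c e| ≤ r` there, colour by colour. [folklore] -/
theorem abs_colour_le_of_sum_sq_le (hr : 0 ≤ r) (hϑ : ∀ e, e ∉ boxEdges 4 (2 * H + 1) → ∑ c, ϑ c e ^ 2 ≤ r ^ 2) (c : Fin D)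
    (e : Literature.MathematicalPhysics.QuantumLattice.ZdEdge 4) (he : e ∉ boxEdges 4 (2 * H + 1)) : |ϑ c e| ≤ r :=
  abs_apply_le_of_sum_sq_le' (v := fun c' => ϑ c' e) hr (hϑ e he) c

/-- `|√β| = √β`. [folklore] -/
theorem abs_sqrt_eq (β : ℝ) : |Real.sqrt β| = Real.sqrt β := abs_of_nonneg (Real.sqrt_nonneg _)

/-- **The scaled datum on the pinned edges of the enlarged box**: `|sdatE β ϑ c e| ≤ √β·r`. [folklore] -/
theorem abs_sdatE_le_of_pinned (hr : 0 ≤ r) (hϑ : ∀ e, e ∉ boxEdges 4 (2 * H + 1) → ∑ c, ϑ c e ^ 2 ≤ r ^ 2)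
    (hforest : ∀ x : Site 4, (∀ k : Fin 4, 1 ≤ x k ∧ x k + 1 ≤ 2 * (H : ℤ)) → ∀ c, ϑ c (x, 0) = 0) (c : Fin D)
    (e : Literature.MathematicalPhysics.QuantumLattice.ZdEdge 4) (he : e ∈ boxEdgesAt dirCorner (2 * H + 3)) (hpin : e ∉ dirFreeEdges H) :
    |sdatE β ϑ c e| ≤ Real.sqrt β * r := by
  have h := abs_smul_apply_le_of_pinned (s := Real.sqrt β) hr (fun e' he' => abs_colour_le_of_sum_sq_le hr hϑ c e' he')
    (fun x hx => hforest x hx c) e he hpin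
  rw [abs_sqrt_eq] at h
  rw [sdatE_eq_smul]
  exact h

/-- Off the cold box the glued scaled datum of colour `c` is `≤ √β·r` in absolute value, whatever the free data. [folklore] -/
theorem abs_glue_sdatE_le_of_not_mem (hr : 0 ≤ r) (hϑ : ∀ e, e ∉ boxEdges 4 (2 * H + 1) → ∑ c, ϑ c e ^ 2 ≤ r ^ 2) (c : Fin D)
    (m : DirFree H → ℝ) {e : Literature.MathematicalPhysics.QuantumLattice.ZdEdge 4} (he : e ∉ boxEdges 4 (2 * H + 1)) :
    |glue (pin := fun e => e ∉ dirFreeEdges H) dirCorner (2 * H + 3) (sdatE β ϑ c) m e| ≤ Real.sqrt β * r := by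
  have h := abs_glue_smul_le_of_not_mem (s := Real.sqrt β) hr (fun e' he' => abs_colour_le_of_sum_sq_le hr hϑ c e' he') m he
  rw [abs_sqrt_eq] at h
  rw [sdatE_eq_smul]
  exact h

/-- **Off the touching plaquettes the scaled background circulation of colour `c` is a pure datum circulation**, hence `≤ 4(√β·r)`. [folklore] -/
theorem abs_dirBackground_sdatE_le_of_not_touching (hr : 0 ≤ r) (hϑ : ∀ e, e ∉ boxEdges 4 (2 * H + 1) → ∑ c, ϑ c e ^ 2 ≤ r ^ 2)
    (hforest : ∀ x : Site 4, (∀ k : Fin 4, 1 ≤ x k ∧ x k + 1 ≤ 2 * (H : ℤ)) → ∀ c, ϑ c (x, 0) = 0) (c : Fin D)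
    {p : ZdPlaquette 4} (hp : p ∉ plaquettesTouching (boxEdges 4 (2 * H + 1))) :
    |sCirc (glue (pin := fun e => e ∉ dirFreeEdges H) dirCorner (2 * H + 3) (sdatE β ϑ c)
        (mean (fun e => e ∉ dirFreeEdges H) dirCorner (2 * H + 3) (sdatE β ϑ c))) (p.1, p.2.1.1, p.2.1.2)| ≤ 4 * (Real.sqrt β * r) := by
  have h := abs_dirBackground_smul_le_of_not_touching (s := Real.sqrt β) hr (fun e' he' => abs_colour_le_of_sum_sq_le hr hϑ c e' he')
    (fun x hx => hforest x hx c) hp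
  rw [abs_sqrt_eq] at h
  rw [sdatE_eq_smul]
  exact h

/-- **The scaled background circulation is uniformly bounded on ALL plaquettes**, `D` colours: `|F̄_c(p)| ≤ √(β·B) + 4(√β·r)` from the energy
clause `Σ_c M_{ϑ_c}(s_c) ≤ B` of the datum package and the datum bound `Σ_c ϑ_c(e)² ≤ r²` off the cold box. [folklore] -/
theorem abs_dirBackground_sdatE_le {B : ℝ} (hβ : 0 ≤ β) (hr : 0 ≤ r)
    (hϑ : ∀ e, e ∉ boxEdges 4 (2 * H + 1) → ∑ c, ϑ c e ^ 2 ≤ r ^ 2)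
    (hforest : ∀ x : Site 4, (∀ k : Fin 4, 1 ≤ x k ∧ x k + 1 ≤ 2 * (H : ℤ)) → ∀ c, ϑ c (x, 0) = 0)
    (s : Fin D → DirFree H → ℝ) (hE : ∑ c, formM (fun e => e ∉ dirFreeEdges H) dirCorner (2 * H + 3) (ϑ c) (s c) ≤ B)
    (c : Fin D) (p : ZdPlaquette 4) :
    |sCirc (glue (pin := fun e => e ∉ dirFreeEdges H) dirCorner (2 * H + 3) (sdatE β ϑ c)
        (mean (fun e => e ∉ dirFreeEdges H) dirCorner (2 * H + 3) (sdatE β ϑ c))) (p.1, p.2.1.1, p.2.1.2)| ≤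
      Real.sqrt (β * B) + 4 * (Real.sqrt β * r) := by
  have hBc : formM (fun e => e ∉ dirFreeEdges H) dirCorner (2 * H + 3) (ϑ c) (s c) ≤ B :=
    (Finset.single_le_sum (f := fun c' => formM (fun e => e ∉ dirFreeEdges H) dirCorner (2 * H + 3) (ϑ c') (s c'))
      (fun c' _ => formM_nonneg _ _) (Finset.mem_univ c)).trans hE
  have h := abs_dirBackground_smul_le (s := Real.sqrt β) hr (fun e' he' => abs_colour_le_of_sum_sq_le hr hϑ c e' he')
    (fun x hx => hforest x hx c) (s c) hBc p
  rw [abs_sqrt_eq] at h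
  rw [sdatE_eq_smul, Real.sqrt_mul hβ]
  exact h

end Colours

/-! ## The Gaussian moment constants of the `D`-colour cores -/

section Moments

variable {D : ℕ} {F G : Fin D → ℝ} {R' a b : ℝ}

/-- `Σ_c (F_c⁴ + 3a²) ≤ D(R'⁴ + 3)` when `|F_c| ≤ R'`, `0 ≤ a ≤ 1`. [folklore] -/
theorem sum_pow_four_add_le (hF : ∀ c, |F c| ≤ R') (ha : 0 ≤ a) (ha1 : a ≤ 1) :
    ∑ c, (F c ^ 4 + 3 * a ^ 2) ≤ D * (R' ^ 4 + 3) := by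
  have hF4 : ∀ c, F c ^ 4 ≤ R' ^ 4 := fun c => by
    have h := pow_le_pow_left₀ (abs_nonneg _) (hF c) 4
    rwa [pow_abs, abs_of_nonneg (by positivity : (0 : ℝ) ≤ F c ^ 4)] at h
  have ha2 : a ^ 2 ≤ 1 := by nlinarith
  have hs : ∑ c, (F c ^ 4 + 3 * a ^ 2) ≤ ∑ _c : Fin D, (R' ^ 4 + 3) := Finset.sum_le_sum fun c _ => by linarith [hF4 c]
  rwa [Finset.sum_const, Finset.card_univ, Fintype.card_fin, nsmul_eq_mul] at hs

/-- `Σ_c (F_c⁸ + 105a⁴) ≤ D(R'⁸ + 105)` when `|F_c| ≤ R'`, `0 ≤ a ≤ 1`. [folklore] -/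
theorem sum_pow_eight_add_le (hF : ∀ c, |F c| ≤ R') (ha : 0 ≤ a) (ha1 : a ≤ 1) :
    ∑ c, (F c ^ 8 + 105 * a ^ 4) ≤ D * (R' ^ 8 + 105) := by
  have hF8 : ∀ c, F c ^ 8 ≤ R' ^ 8 := fun c => by
    have h := pow_le_pow_left₀ (abs_nonneg _) (hF c) 8
    rwa [pow_abs, abs_of_nonneg (by positivity : (0 : ℝ) ≤ F c ^ 8)] at h
  have ha4 : a ^ 4 ≤ 1 := pow_le_one₀ ha ha1
  have hs : ∑ c, (F c ^ 8 + 105 * a ^ 4) ≤ ∑ _c : Fin D, (R' ^ 8 + 105) := Finset.sum_le_sum fun c _ => by linarith [hF8 c]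
  rwa [Finset.sum_const, Finset.card_univ, Fintype.card_fin, nsmul_eq_mul] at hs

/-- **The second-moment constant**: `2DΣ_c(F_c⁴+3a²) + 2DΣ_c(G_c⁴+3b²) ≤ (2D(R'²+2))²` and its square root is `≤ 2D(R'²+2)`, when
`|F_c|, |G_c| ≤ R'` and `a, b ∈ [0,1]`. [folklore] -/
theorem sqrt_momentD_two_le (hF : ∀ c, |F c| ≤ R') (hG : ∀ c, |G c| ≤ R') (ha : 0 ≤ a) (ha1 : a ≤ 1) (hb : 0 ≤ b) (hb1 : b ≤ 1) :
    2 * (D : ℝ) * ∑ c, (F c ^ 4 + 3 * a ^ 2) + 2 * D * ∑ c, (G c ^ 4 + 3 * b ^ 2) ≤ (2 * D * (R' ^ 2 + 2)) ^ 2 ∧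
      Real.sqrt (2 * (D : ℝ) * ∑ c, (F c ^ 4 + 3 * a ^ 2) + 2 * D * ∑ c, (G c ^ 4 + 3 * b ^ 2)) ≤ 2 * D * (R' ^ 2 + 2) := by
  have h1 := sum_pow_four_add_le (D := D) hF ha ha1
  have h2 := sum_pow_four_add_le (D := D) hG hb hb1
  have hD : (0 : ℝ) ≤ D := Nat.cast_nonneg _
  have hsq : 2 * (D : ℝ) * ∑ c, (F c ^ 4 + 3 * a ^ 2) + 2 * D * ∑ c, (G c ^ 4 + 3 * b ^ 2) ≤ (2 * D * (R' ^ 2 + 2)) ^ 2 := by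
    have hD1 : (D : ℝ) * (R' ^ 4 + 3) ≤ D * D * (R' ^ 4 + 3) := by
      rcases Nat.eq_zero_or_pos D with hD0 | hDpos
      · subst hD0; simp
      · have : (1 : ℝ) ≤ D := by exact_mod_cast hDpos
        have : 0 ≤ (D : ℝ) * (R' ^ 4 + 3) := by positivity
        nlinarith
    calc 2 * (D : ℝ) * ∑ c, (F c ^ 4 + 3 * a ^ 2) + 2 * D * ∑ c, (G c ^ 4 + 3 * b ^ 2)
        ≤ 2 * D * (D * (R' ^ 4 + 3)) + 2 * D * (D * (R' ^ 4 + 3)) := by gcongr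
      _ = 4 * (D * D * (R' ^ 4 + 3)) := by ring
      _ ≤ (2 * D * (R' ^ 2 + 2)) ^ 2 := by nlinarith [sq_nonneg R', sq_nonneg (D : ℝ)]
  refine ⟨hsq, ?_⟩
  exact (Real.sqrt_le_sqrt hsq).trans_eq (Real.sqrt_sq (by positivity))

/-- **The fourth-moment constant**: `√((8D³Σ_c(F_c⁸+105a⁴) + 8D³Σ_c(G_c⁸+105b⁴))/2) ≤ 3D²(R'⁴+11)` when `|F_c|, |G_c| ≤ R'` and
`a, b ∈ [0,1]`. [folklore] -/
theorem sqrt_momentD_four_le (hF : ∀ c, |F c| ≤ R') (hG : ∀ c, |G c| ≤ R') (ha : 0 ≤ a) (ha1 : a ≤ 1) (hb : 0 ≤ b) (hb1 : b ≤ 1) :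
    (8 * (D : ℝ) ^ 3 * ∑ c, (F c ^ 8 + 105 * a ^ 4) + 8 * (D : ℝ) ^ 3 * ∑ c, (G c ^ 8 + 105 * b ^ 4)) / 2 ≤ (3 * (D : ℝ) ^ 2 * (R' ^ 4 + 11)) ^ 2 ∧
      Real.sqrt ((8 * (D : ℝ) ^ 3 * ∑ c, (F c ^ 8 + 105 * a ^ 4) + 8 * (D : ℝ) ^ 3 * ∑ c, (G c ^ 8 + 105 * b ^ 4)) / 2) ≤
        3 * (D : ℝ) ^ 2 * (R' ^ 4 + 11) := by
  have h1 := sum_pow_eight_add_le (D := D) hF ha ha1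
  have h2 := sum_pow_eight_add_le (D := D) hG hb hb1
  have hD : (0 : ℝ) ≤ D := Nat.cast_nonneg _
  have hD3 : (0 : ℝ) ≤ (D : ℝ) ^ 3 := by positivity
  have hsq : (8 * (D : ℝ) ^ 3 * ∑ c, (F c ^ 8 + 105 * a ^ 4) + 8 * (D : ℝ) ^ 3 * ∑ c, (G c ^ 8 + 105 * b ^ 4)) / 2 ≤
      (3 * (D : ℝ) ^ 2 * (R' ^ 4 + 11)) ^ 2 := by
    have hnum : 8 * (D : ℝ) ^ 3 * ∑ c, (F c ^ 8 + 105 * a ^ 4) + 8 * (D : ℝ) ^ 3 * ∑ c, (G c ^ 8 + 105 * b ^ 4) ≤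
        16 * ((D : ℝ) ^ 4 * (R' ^ 8 + 105)) := by
      calc _ ≤ 8 * (D : ℝ) ^ 3 * (D * (R' ^ 8 + 105)) + 8 * (D : ℝ) ^ 3 * (D * (R' ^ 8 + 105)) := by gcongr
        _ = 16 * ((D : ℝ) ^ 4 * (R' ^ 8 + 105)) := by ring
    have hR8 : 0 ≤ R' ^ 8 := by positivity
    have hR4 : 0 ≤ R' ^ 4 := by positivity
    have hD4 : 0 ≤ (D : ℝ) ^ 4 := by positivity
    have e : (3 * (D : ℝ) ^ 2 * (R' ^ 4 + 11)) ^ 2 = 9 * ((D : ℝ) ^ 4 * (R' ^ 8 + 22 * R' ^ 4 + 121)) := by ring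
    rw [e]
    have hX : 0 ≤ (D : ℝ) ^ 4 * (R' ^ 8 + 22 * R' ^ 4 + 121) := by positivity
    have hmono : (D : ℝ) ^ 4 * (R' ^ 8 + 105) ≤ (D : ℝ) ^ 4 * (R' ^ 8 + 22 * R' ^ 4 + 121) :=
      mul_le_mul_of_nonneg_left (by nlinarith) hD4
    linarith
  refine ⟨hsq, ?_⟩
  exact (Real.sqrt_le_sqrt hsq).trans_eq (Real.sqrt_sq (by positivity))

end Moments

end Summit.QuantumFields.YangMills.Theorems.ColdBoxAllGroups

end
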